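import Literature.NumberTheory.Automorphic.BrandtEichlerLevelUOperators
import Literature.NumberTheory.Automorphic.BrandtMultiplicativityHolds
import HarnessLib

/-!
# `U_ℓ T_n = T_n U_ℓ`, `U_ℓ U_{ℓ'} = U_{ℓ'} U_ℓ`, and the commutativity of the full Hecke
# algebra `𝕋_{N⁺,N⁻}` of a Brandt setup

Topic `NumberTheory/Automorphic`; theorems only (no definition, no named fact, no instance).
Sequel of `BrandtEichlerLevelUOperators.lean` (the `U`-operators `Brandt.uMatrix O O₁ O₂ ℓ` at the
primes dividing the Eichler level, for an orientation `(O₁, O₂)`, as filtered Brandt matrices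
`Brandt.matrixWith O (IsForward O₁ O₂ ℓ) ℓ`). Hecke operators attached to double cosets at
DIFFERENT primes commute (W. Zhang 2014 §3.9: `𝕋_{N⁺,N⁻m}` "the Hecke algebra generated by `T_ℓ`
… and `U_ℓ`", a commutative ring; Voight Cor. 41.3.15 for the part prime to the level; Eichler
1973 II §6 Thm. 2 / Vignéras III §5 ex. 5.8 (c)–(d): `B(m) B(n) = B(mn) = B(n) B(m)` for
`(m, n) = 1`, the tree's `Brandt.matrix_mul_of_coprime`). Here this is PROVED for the tree's
ideal-theoretic `U_ℓ` by Eichler's unique-factorisation argument with a side condition: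

* `Brandt.matrixWith_mul_matrixWith_of_coprime` — **the filtered double count**: for coprime
  `m, n` and predicates `Q` (inner, index `m²`, translation invariant) and `P` (outer, index `n²`)
  which, along every chain `M ⊆ L ⊆ I` with `[L : M] = m²`, `[I : L] = n²`, read as one bottom
  predicate `R M I` (`P L I ∧ Q M L ↔ R M I`), one has `T_Q(m) T_P(n) = T_R(mn)` — Eichler's
  bijection `M ↦ (L(M), M)` (`Brandt.nonempty_equiv_pairsWith`, from the tree's
  `exists_unique_intermediate_of_coprime`) and the grouping of pairs by the class of `L`
  (`Brandt.card_pairsWith_eq_sum`, `ncard_subidealsWith_smul`), under the two standing hypotheses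
  of `BrandtMultiplicativity.lean` (unit translates and coprime-index intermediate lattices of
  invertible right ideals are invertible right ideals — discharged for totally definite
  quaternion algebras over `ℚ` in `BrandtMultiplicativityHolds.lean`).
* `Brandt.isForward_iff_of_coprime_outer` / `_inner` — **the forward condition is read at the
  bottom of a chain of index prime to `ℓ`** (Bezout in `I O₁ / ℓ I O₁`): for `M ⊆ L ⊆ I`,
  `IsForward ℓ M L ↔ IsForward ℓ M I` if `gcd([I : L], ℓ) = 1`, and
  `IsForward ℓ L I ↔ IsForward ℓ M I` if `gcd([L : M], ℓ) = 1`.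
* `Brandt.uMatrix_mul_matrix_comm_of_forall_mem_rightIdeals`, `Brandt.uMatrix_mul_matrix_comm`,
  `Brandt.XiSetup.uMatrix_mul_matrix_comm` — **`U_ℓ T(n) = T(n) U_ℓ` for `gcd(ℓ, n) = 1`**
  (both are the filtered matrix of index `ℓ n` for the forward filter);
  `Brandt.uMatrix_mul_uMatrix_comm(_of_forall_mem_rightIdeals)`, `Brandt.XiSetup.uMatrix_mul_uMatrix_comm`
  — **`U_ℓ U_{ℓ'} = U_{ℓ'} U_ℓ`** for coprime `ℓ, ℓ'` (same orientation data);
* `Brandt.XiSetup.heckeAt_comm` — the Hecke matrices `S.heckeAt p` (`U_p` at `p ∣ N⁺`, `T(p)`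
  otherwise) of a Brandt setup at any two primes commute; hence
  `Brandt.XiSetup.fullHeckeAlgebra_comm` — **the full Hecke algebra `𝕋_{N⁺,N⁻}(S)` is
  commutative** (Mathlib `Algebra.isMulCommutative_adjoin`; no instance is registered).

What is NOT here: `U_ℓ T(n)` for `ℓ ∣ n`; `U_ℓ = T(ℓ)` at `ℓ ∤ N⁺`; relations between `U_ℓ` and
the Atkin–Lehner involutions.

## References

* [WZhang2014] W. Zhang, Camb. J. Math. 2 (2014), §3.9 p. 214, §6.1 p. 226.
* [Eichler1973] M. Eichler, LNM 320 (1973), Ch. II §6 Thm. 2 (18), (23).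
* [VignerasLNM800] M.-F. Vignéras, LNM 800 (1980), Ch. III §5 exercice 5.8 (c)–(d).
* [Voight2021] J. Voight, *Quaternion Algebras*, GTM 288, (41.1.1), Cor. 41.3.15.
-/

noncomputable section

open scoped Pointwise Matrix

universe u

namespace Literature.NumberTheory.Automorphic

namespace Brandt

variable {D : Type u} [Ring D]

/-- Bezout in a `ℤ`-module: `a x ∈ S` and `b x ∈ S` with `gcd(a,b) = 1` give `x ∈ S`. [folklore] -/
private theorem mem_of_coprime_smul_mem {M : Type*} [AddCommGroup M] {S : Submodule ℤ M} {x : M} {a b : ℕ}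
    (hab : Nat.Coprime a b) (ha : (a : ℤ) • x ∈ S) (hb : (b : ℤ) • x ∈ S) : x ∈ S := by
  obtain ⟨u, v, huv⟩ := Nat.isCoprime_iff_coprime.mpr hab
  have : x = u • ((a : ℤ) • x) + v • ((b : ℤ) • x) := by
    rw [smul_smul, smul_smul, ← add_smul, huv, one_smul]
  rw [this]
  exact S.add_mem (S.smul_mem u ha) (S.smul_mem v hb)

/-- `[I : L] • (I T) ⊆ L T` (Lagrange in `I / L`). [folklore] -/
private theorem relIndex_smul_mul_le (L I T : Submodule ℤ D) :
    ((L.toAddSubgroup.relIndex I.toAddSubgroup : ℕ) : ℤ) • (I * T) ≤ L * T := by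
  intro z hz
  obtain ⟨w, hw, rfl⟩ := (Submodule.mem_smul_pointwise_iff_exists _ _ _).mp hz
  refine Submodule.mul_induction_on hw (fun x hx y hy => ?_) (fun z w hz hw => ?_)
  · rw [← smul_mul_assoc, natCast_zsmul]
    exact Submodule.mul_mem_mul (relIndex_nsmul_mem (J := L) hx) hy
  · rw [smul_add]; exact Submodule.add_mem _ hz hw

/-- **Claim A** (the forward condition of the inner step is read at the bottom): for a chain
`M ⊆ L ⊆ I` with `[I : L]` prime to `ℓ` and `𝒯 ⊆ O₁`, `M 𝒯 ⊆ ℓ L O₁ ↔ M 𝒯 ⊆ ℓ I O₁` (Bezout in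
`I O₁ / ℓ I O₁`). [cite: Eichler1973, Ch. II §6 Thm. 2 (18) and (23) (unique factorisation, with a side condition)] -/
theorem mul_le_smul_mul_iff_of_coprime_outer {O₁ : Submodule ℤ D} {T M L I : Submodule ℤ D}
    (hT : T ≤ O₁) (hML : M ≤ L) (hLI : L ≤ I) {ℓ : ℕ}
    (hcop : Nat.Coprime (L.toAddSubgroup.relIndex I.toAddSubgroup) ℓ) :
    M * T ≤ (ℓ : ℤ) • (L * O₁) ↔ M * T ≤ (ℓ : ℤ) • (I * O₁) := by
  constructor
  · intro h
    exact h.trans (zsmul_le_zsmul (mul_le_mul_left hLI O₁) _)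
  · intro h x hx
    obtain ⟨y, hy, rfl⟩ := (Submodule.mem_smul_pointwise_iff_exists _ _ _).mp (h hx)
    refine Submodule.smul_mem_pointwise_smul _ _ _ (mem_of_coprime_smul_mem hcop ?_ ?_)
    · exact relIndex_smul_mul_le L I O₁ (Submodule.smul_mem_pointwise_smul _ _ _ hy)
    · exact mul_le_mul' hML hT hx

/-- **Claim B** (the forward condition of the outer step is read at the bottom): for a chain
`M ⊆ L ⊆ I` with `[L : M]` prime to `ℓ` and `𝒯 ⊆ O₁`, `L 𝒯 ⊆ ℓ I O₁ ↔ M 𝒯 ⊆ ℓ I O₁` (Bezout in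
`I O₁ / ℓ I O₁`). [cite: Eichler1973, Ch. II §6 Thm. 2 (18) and (23) (unique factorisation, with a side condition)] -/
theorem mul_le_smul_mul_iff_of_coprime_inner {O₁ : Submodule ℤ D} {T M L I : Submodule ℤ D}
    (hT : T ≤ O₁) (hML : M ≤ L) (hLI : L ≤ I) {ℓ : ℕ}
    (hcop : Nat.Coprime (M.toAddSubgroup.relIndex L.toAddSubgroup) ℓ) :
    L * T ≤ (ℓ : ℤ) • (I * O₁) ↔ M * T ≤ (ℓ : ℤ) • (I * O₁) := by
  constructor
  · intro h
    exact (mul_le_mul_left hML T).trans h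
  · intro h x hx
    have hxI : x ∈ I * O₁ := mul_le_mul' hLI hT hx
    refine mem_of_coprime_smul_mem (S := (ℓ : ℤ) • (I * O₁)) hcop ?_ ?_
    · exact h (relIndex_smul_mul_le M L T (Submodule.smul_mem_pointwise_smul _ _ _ hx))
    · exact Submodule.smul_mem_pointwise_smul _ _ _ hxI

/-- **The forward condition of the inner step of a chain `M ⊆ L ⊆ I` with `gcd([I : L], ℓ) = 1`
is read at the bottom**: `IsForward ℓ M L ↔ IsForward ℓ M I`. [cite: Eichler1973, Ch. II §6 Thm. 2 (18) and (23) (unique factorisation, with a side condition)] -/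
theorem isForward_iff_of_coprime_outer {O₁ O₂ M L I : Submodule ℤ D} (hML : M ≤ L) (hLI : L ≤ I)
    {ℓ : ℕ} (hcop : Nat.Coprime (L.toAddSubgroup.relIndex I.toAddSubgroup) ℓ) :
    IsForward O₁ O₂ ℓ M L ↔ IsForward O₁ O₂ ℓ M I :=
  not_congr (mul_le_smul_mul_iff_of_coprime_outer (link_le_left O₁ O₂) hML hLI hcop)

/-- **The forward condition of the outer step of a chain `M ⊆ L ⊆ I` with `gcd([L : M], ℓ) = 1`
is read at the bottom**: `IsForward ℓ L I ↔ IsForward ℓ M I`. [cite: Eichler1973, Ch. II §6 Thm. 2 (18) and (23) (unique factorisation, with a side condition)] -/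
theorem isForward_iff_of_coprime_inner {O₁ O₂ M L I : Submodule ℤ D} (hML : M ≤ L) (hLI : L ≤ I)
    {ℓ : ℕ} (hcop : Nat.Coprime (M.toAddSubgroup.relIndex L.toAddSubgroup) ℓ) :
    IsForward O₁ O₂ ℓ L I ↔ IsForward O₁ O₂ ℓ M I :=
  not_congr (mul_le_smul_mul_iff_of_coprime_inner (link_le_left O₁ O₂) hML hLI hcop)

/-! ### The filtered double count -/

/-- **Filtered pairs versus filtered sub-ideals of index `(mn)²`** (`gcd(m, n) = 1`): Eichler's
bijection `M ↦ (L(M), M)`, `L(M)` the unique intermediate lattice of index `n²` in `I_j`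
(`exists_unique_intermediate_of_coprime`), restricted to the sub-ideals satisfying the bottom
predicate `R` on one side and to the pairs satisfying `P` (outer) and `Q` (inner) on the other,
granted `P L I ∧ Q M L ↔ R M I` along chains; under the two standing hypotheses of
`BrandtMultiplicativity.lean`. [cite: Eichler1973, Ch. II §6 Thm. 2 (18) and (23) (unique factorisation, with a side condition)] -/
theorem nonempty_equiv_pairsWith {O : Submodule ℤ D}
    (hcl : ∀ I ∈ rightIdeals O, ∀ β : Dˣ, β • I ∈ rightIdeals O)
    (hK : ∀ M ∈ rightIdeals O, ∀ I ∈ rightIdeals O, ∀ K : Submodule ℤ D, M ≤ K → K ≤ I →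
      Nat.Coprime (M.toAddSubgroup.relIndex K.toAddSubgroup)
        (K.toAddSubgroup.relIndex I.toAddSubgroup) → K ∈ rightIdeals O)
    {P Q R : Submodule ℤ D → Submodule ℤ D → Prop}
    {m n : ℕ} (hm : m ≠ 0) (hn : n ≠ 0) (hmn : Nat.Coprime m n)
    (hR : ∀ M L I : Submodule ℤ D, M ≤ L → L ≤ I →
      M.toAddSubgroup.relIndex L.toAddSubgroup = m ^ 2 →
      L.toAddSubgroup.relIndex I.toAddSubgroup = n ^ 2 → (P L I ∧ Q M L ↔ R M I))
    (i j : ClassSet O) :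
    Nonempty ({M : Submodule ℤ D // M ≤ j.rep ∧
        M.toAddSubgroup.relIndex j.rep.toAddSubgroup = (m * n) ^ 2 ∧ R M j.rep ∧
        ∃ α : Dˣ, M = α • i.rep} ≃
      {p : Submodule ℤ D × Submodule ℤ D // (p.1 ≤ j.rep ∧
        p.1.toAddSubgroup.relIndex j.rep.toAddSubgroup = n ^ 2 ∧ p.1 ∈ rightIdeals O ∧ P p.1 j.rep) ∧
        (p.2 ≤ p.1 ∧ p.2.toAddSubgroup.relIndex p.1.toAddSubgroup = m ^ 2 ∧ Q p.2 p.1 ∧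
          ∃ α : Dˣ, p.2 = α • i.rep)}) := by
  classical
  have hcop : Nat.Coprime (m ^ 2) (n ^ 2) := Nat.Coprime.pow 2 2 hmn
  have hmn0 : m ^ 2 * n ^ 2 ≠ 0 := mul_ne_zero (pow_ne_zero 2 hm) (pow_ne_zero 2 hn)
  have hex : ∀ M : {M : Submodule ℤ D // M ≤ j.rep ∧
      M.toAddSubgroup.relIndex j.rep.toAddSubgroup = (m * n) ^ 2 ∧ R M j.rep ∧
      ∃ α : Dˣ, M = α • i.rep},
      ∃ K : Submodule ℤ D, M.1 ≤ K ∧ K ≤ j.rep ∧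
        M.1.toAddSubgroup.relIndex K.toAddSubgroup = m ^ 2 ∧
        K.toAddSubgroup.relIndex j.rep.toAddSubgroup = n ^ 2 ∧
        ∀ K' : Submodule ℤ D, M.1 ≤ K' → K' ≤ j.rep →
          M.1.toAddSubgroup.relIndex K'.toAddSubgroup = m ^ 2 → K' = K := fun M =>
    exists_unique_intermediate_of_coprime M.2.1 hcop hmn0 (by rw [M.2.2.1]; ring)
  choose L hML hLI hidxML hidxLI huniq using hex
  have hLmem : ∀ M, L M ∈ rightIdeals O := fun M => by
    obtain ⟨α, hα⟩ := M.2.2.2.2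
    have hMmem : M.1 ∈ rightIdeals O := by rw [hα]; exact hcl _ i.rep_mem α
    exact hK M.1 hMmem j.rep j.rep_mem (L M) (hML M) (hLI M) (by rw [hidxML, hidxLI]; exact hcop)
  have hPQ : ∀ M, P (L M) j.rep ∧ Q M.1 (L M) := fun M =>
    (hR M.1 (L M) j.rep (hML M) (hLI M) (hidxML M) (hidxLI M)).mpr M.2.2.2.1
  have bwd : ∀ p : {p : Submodule ℤ D × Submodule ℤ D // (p.1 ≤ j.rep ∧
      p.1.toAddSubgroup.relIndex j.rep.toAddSubgroup = n ^ 2 ∧ p.1 ∈ rightIdeals O ∧ P p.1 j.rep) ∧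
      (p.2 ≤ p.1 ∧ p.2.toAddSubgroup.relIndex p.1.toAddSubgroup = m ^ 2 ∧ Q p.2 p.1 ∧
        ∃ α : Dˣ, p.2 = α • i.rep)},
      p.1.2 ≤ j.rep ∧ p.1.2.toAddSubgroup.relIndex j.rep.toAddSubgroup = (m * n) ^ 2 ∧
        R p.1.2 j.rep ∧ ∃ α : Dˣ, p.1.2 = α • i.rep := fun p => by
    refine ⟨p.2.2.1.trans p.2.1.1, ?_, ?_, p.2.2.2.2.2⟩
    · rw [← AddSubgroup.relIndex_mul_relIndex p.1.2.toAddSubgroup p.1.1.toAddSubgroup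
        j.rep.toAddSubgroup (Submodule.toAddSubgroup_mono p.2.2.1)
        (Submodule.toAddSubgroup_mono p.2.1.1), p.2.2.2.1, p.2.1.2.1]
      ring
    · exact (hR p.1.2 p.1.1 j.rep p.2.2.1 p.2.1.1 p.2.2.2.1 p.2.1.2.1).mp ⟨p.2.1.2.2.2, p.2.2.2.2.1⟩
  refine ⟨⟨fun M => ⟨(L M, M.1), ⟨hLI M, hidxLI M, hLmem M, (hPQ M).1⟩, hML M, hidxML M, (hPQ M).2,
      M.2.2.2.2⟩,
    fun p => ⟨p.1.2, bwd p⟩, fun M => Subtype.ext rfl, fun p => Subtype.ext ?_⟩⟩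
  have hLp : L ⟨p.1.2, bwd p⟩ = p.1.1 :=
    (huniq ⟨p.1.2, bwd p⟩ p.1.1 p.2.2.1 p.2.1.1 p.2.2.2.1).symm
  show (L ⟨p.1.2, bwd p⟩, p.1.2) = p.1
  rw [hLp]

/-- **The filtered pairs are counted by `Σ_k T_Q(m)_ik T_P(n)_kj`**: group the pairs `(L, M)` by
the class `k` of `L` and compute the inner count on the representative of `k` (translation
invariance of `Q`, `ncard_subidealsWith_smul`). [cite: Eichler1973, Ch. II §6 Thm. 2 (18) and (23) (unique factorisation, with a side condition)] -/
theorem card_pairsWith_eq_sum [IsAddTorsionFree D] {O : Submodule ℤ D} [Fintype (ClassSet O)]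
    (hcl : ∀ I ∈ rightIdeals O, ∀ β : Dˣ, β • I ∈ rightIdeals O)
    {P Q : Submodule ℤ D → Submodule ℤ D → Prop} (hQ : IsTranslationInvariant Q)
    {m n : ℕ} (hm : m ≠ 0) (hn : n ≠ 0) (i j : ClassSet O) :
    Nat.card {p : Submodule ℤ D × Submodule ℤ D // (p.1 ≤ j.rep ∧
        p.1.toAddSubgroup.relIndex j.rep.toAddSubgroup = n ^ 2 ∧ p.1 ∈ rightIdeals O ∧ P p.1 j.rep) ∧
        (p.2 ≤ p.1 ∧ p.2.toAddSubgroup.relIndex p.1.toAddSubgroup = m ^ 2 ∧ Q p.2 p.1 ∧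
          ∃ α : Dˣ, p.2 = α • i.rep)} =
      ∑ k : ClassSet O, (subidealsWith Q m i.rep k.rep).ncard * (subidealsWith P n k.rep j.rep).ncard := by
  classical
  set U : Set (Submodule ℤ D) := {L | L ≤ j.rep ∧
    L.toAddSubgroup.relIndex j.rep.toAddSubgroup = n ^ 2 ∧ L ∈ rightIdeals O ∧ P L j.rep} with hU
  set B : ClassSet O → Set (Submodule ℤ D) := fun k => subidealsWith P n k.rep j.rep with hB
  set C : Submodule ℤ D → Set (Submodule ℤ D) := fun L' => subidealsWith Q m i.rep L' with hC
  set big : Set (Submodule ℤ D) := {M | M ≤ j.rep ∧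
    M.toAddSubgroup.relIndex j.rep.toAddSubgroup = (m * n) ^ 2 ∧ True} with hbig
  have hUfin : U.Finite :=
    (finite_setOf_subideal j.rep_mem.1.1 hn (fun L => L ∈ rightIdeals O ∧ P L j.rep)).subset
      fun L hL => ⟨hL.1, hL.2.1, hL.2.2⟩
  have hBfin : ∀ k, (B k).Finite := fun k => finite_subidealsWith P k j hn
  have hbigfin : big.Finite := finite_setOf_subideal j.rep_mem.1.1 (mul_ne_zero hm hn) _
  have hCbig : ∀ L' ∈ U, C L' ⊆ big := by
    rintro L' ⟨hle, hidx, -⟩ M ⟨hML, hidxM, -⟩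
    refine ⟨hML.trans hle, ?_, trivial⟩
    rw [← AddSubgroup.relIndex_mul_relIndex M.toAddSubgroup L'.toAddSubgroup j.rep.toAddSubgroup
      (Submodule.toAddSubgroup_mono hML) (Submodule.toAddSubgroup_mono hle), hidxM, hidx]
    ring
  have hmemU : ∀ L', L' ∈ U ↔ ∃ k, L' ∈ B k := fun L' => by
    constructor
    · rintro ⟨hle, hidx, hmem, hPL⟩
      obtain ⟨β, hβ⟩ := exists_rep_mk_eq_smul (⟨L', hmem⟩ : rightIdeals O)
      refine ⟨Quotient.mk (rightClassSetoid O) ⟨L', hmem⟩, hle, hidx, hPL, β⁻¹, ?_⟩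
      rw [hβ, inv_smul_smul]
    · rintro ⟨k, hle, hidx, hPL, β, rfl⟩
      exact ⟨hle, hidx, hcl _ k.rep_mem β, hPL⟩
  have hdisj : ∀ k k', k ≠ k' → Disjoint (B k) (B k') := fun k k' hkk' => by
    rw [Set.disjoint_left]
    rintro L' ⟨-, -, -, β, hβ⟩ ⟨-, -, -, β', hβ'⟩
    apply hkk'
    have h : k'.rep = (β'⁻¹ * β) • k.rep := by rw [mul_smul, ← hβ, hβ', inv_smul_smul]
    exact ClassSet.eq_of_rep_eq_smul h
  have hCB : ∀ k, ∀ L' ∈ B k, (C L').ncard = (C k.rep).ncard := by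
    rintro k L' ⟨-, -, -, β, rfl⟩
    have h := ncard_subidealsWith_smul hQ β 1 m i.rep k.rep
    rw [one_smul] at h
    exact h
  let S : Finset (Submodule ℤ D) := hUfin.toFinset
  let T : Submodule ℤ D → Finset (Submodule ℤ D) := fun L' => hbigfin.toFinset.filter (· ∈ C L')
  have hmemS : ∀ L', L' ∈ S ↔ L' ∈ U := fun L' => Set.Finite.mem_toFinset hUfin
  have hmemT : ∀ L' ∈ U, ∀ M, M ∈ T L' ↔ M ∈ C L' := fun L' hL' M => by
    simp only [T, Finset.mem_filter, Set.Finite.mem_toFinset]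
    exact ⟨fun h => h.2, fun h => ⟨hCbig L' hL' h, h⟩⟩
  have hstep1 : Nat.card {p : Submodule ℤ D × Submodule ℤ D // (p.1 ≤ j.rep ∧
      p.1.toAddSubgroup.relIndex j.rep.toAddSubgroup = n ^ 2 ∧ p.1 ∈ rightIdeals O ∧ P p.1 j.rep) ∧
      (p.2 ≤ p.1 ∧ p.2.toAddSubgroup.relIndex p.1.toAddSubgroup = m ^ 2 ∧ Q p.2 p.1 ∧
        ∃ α : Dˣ, p.2 = α • i.rep)} = (S.sigma T).card := by
    rw [← Nat.card_eq_finsetCard]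
    refine Nat.card_congr
      { toFun := fun p => ⟨⟨p.1.1, p.1.2⟩, Finset.mem_sigma.mpr
          ⟨(hmemS _).mpr p.2.1, (hmemT _ p.2.1 _).mpr p.2.2⟩⟩
        invFun := fun q => ⟨(q.1.1, q.1.2), (hmemS _).mp (Finset.mem_sigma.mp q.2).1,
          (hmemT _ ((hmemS _).mp (Finset.mem_sigma.mp q.2).1) _).mp (Finset.mem_sigma.mp q.2).2⟩
        left_inv := fun p => rfl
        right_inv := fun q => rfl }
  have hstep2 : (S.sigma T).card = ∑ L' ∈ S, (C L').ncard := by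
    rw [Finset.card_sigma]
    refine Finset.sum_congr rfl fun L' hL' => ?_
    have hL'U : L' ∈ U := (hmemS L').mp hL'
    have hset : ((T L' : Finset (Submodule ℤ D)) : Set (Submodule ℤ D)) = C L' :=
      Set.ext fun M => by rw [Finset.mem_coe]; exact hmemT L' hL'U M
    rw [← hset, Set.ncard_coe_finset]
  have hS : S = Finset.univ.biUnion fun k => (hBfin k).toFinset := by
    ext L'
    rw [hmemS, hmemU, Finset.mem_biUnion]
    simp only [Finset.mem_univ, true_and, Set.Finite.mem_toFinset]
  have hpd : (↑(Finset.univ : Finset (ClassSet O)) : Set (ClassSet O)).PairwiseDisjoint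
      fun k => (hBfin k).toFinset := fun k _ k' _ hkk' =>
    Set.Finite.disjoint_toFinset.mpr (hdisj k k' hkk')
  have hstep3 : ∑ L' ∈ S, (C L').ncard = ∑ k, ∑ L' ∈ (hBfin k).toFinset, (C L').ncard := by
    rw [hS, Finset.sum_biUnion hpd]
  have hstep4 : ∀ k, ∑ L' ∈ (hBfin k).toFinset, (C L').ncard = (C k.rep).ncard * (B k).ncard :=
    fun k => by
    rw [Finset.sum_congr rfl fun L' hL' => hCB k L' ((Set.Finite.mem_toFinset _).mp hL'),
      Finset.sum_const, smul_eq_mul, mul_comm, ← Set.ncard_eq_toFinset_card (B k) (hBfin k)]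
  rw [hstep1, hstep2, hstep3]
  exact Finset.sum_congr rfl fun k _ => hstep4 k

/-- **`T_Q(m) · T_P(n) = T_R(mn)` for filtered Brandt matrices**, `gcd(m, n) = 1`, `Q` translation
invariant, when the two filters read through every chain as the single bottom filter `R`
(`P L I ∧ Q M L ↔ R M I`); with `P = Q = R = ⊤` this is the tree's
`Brandt.matrix_mul_of_coprime_of_forall_mem_rightIdeals`. [cite: Eichler1973, Ch. II §6 Thm. 2 (18) and (23) (unique factorisation, with a side condition)] -/
theorem matrixWith_mul_matrixWith_of_coprime [IsAddTorsionFree D] {O : Submodule ℤ D}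
    [Fintype (ClassSet O)] [DecidableEq (ClassSet O)]
    (hcl : ∀ I ∈ rightIdeals O, ∀ β : Dˣ, β • I ∈ rightIdeals O)
    (hK : ∀ M ∈ rightIdeals O, ∀ I ∈ rightIdeals O, ∀ K : Submodule ℤ D, M ≤ K → K ≤ I →
      Nat.Coprime (M.toAddSubgroup.relIndex K.toAddSubgroup)
        (K.toAddSubgroup.relIndex I.toAddSubgroup) → K ∈ rightIdeals O)
    {P Q R : Submodule ℤ D → Submodule ℤ D → Prop} (hQ : IsTranslationInvariant Q)
    {m n : ℕ} (hm : m ≠ 0) (hn : n ≠ 0) (hmn : Nat.Coprime m n)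
    (hR : ∀ M L I : Submodule ℤ D, M ≤ L → L ≤ I →
      M.toAddSubgroup.relIndex L.toAddSubgroup = m ^ 2 →
      L.toAddSubgroup.relIndex I.toAddSubgroup = n ^ 2 → (P L I ∧ Q M L ↔ R M I)) :
    matrixWith O Q m * matrixWith O P n = matrixWith O R (m * n) := by
  ext i j
  rw [Matrix.mul_apply]
  obtain ⟨e⟩ := nonempty_equiv_pairsWith hcl hK hm hn hmn hR i j
  have h := card_pairsWith_eq_sum hcl (P := P) hQ hm hn i j
  rw [← Nat.card_congr e] at h
  have hL : matrixWith O R (m * n) i j = (Nat.card {M : Submodule ℤ D // M ≤ j.rep ∧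
      M.toAddSubgroup.relIndex j.rep.toAddSubgroup = (m * n) ^ 2 ∧ R M j.rep ∧
      ∃ α : Dˣ, M = α • i.rep} : ℤ) := by
    rw [matrixWith_apply, ← Nat.card_coe_set_eq]
    rfl
  rw [hL, h]
  push_cast
  refine Finset.sum_congr rfl fun k _ => ?_
  simp only [matrixWith_apply]

/-! ### Consequences: `U_ℓ T_n = T_n U_ℓ` and `U_ℓ U_{ℓ'} = U_{ℓ'} U_ℓ` -/

/-- **`U_ℓ T(n) = T(n) U_ℓ` for `gcd(ℓ, n) = 1`, `ℓ, n ≠ 0`** (abstract form, under the two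
standing hypotheses): both products are the filtered Brandt matrix of index `ℓ n` for the forward
filter at `ℓ` (`isForward_iff_of_coprime_outer/inner`). [cite: WZhang2014, §3.9 p. 214 (`𝕋_{N⁺,N⁻}` generated by `T_ℓ`, `U_ℓ`; commutation)] -/
theorem uMatrix_mul_matrix_comm_of_forall_mem_rightIdeals [IsAddTorsionFree D] {O : Submodule ℤ D}
    [Fintype (ClassSet O)] [DecidableEq (ClassSet O)]
    (hcl : ∀ I ∈ rightIdeals O, ∀ β : Dˣ, β • I ∈ rightIdeals O)
    (hK : ∀ M ∈ rightIdeals O, ∀ I ∈ rightIdeals O, ∀ K : Submodule ℤ D, M ≤ K → K ≤ I →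
      Nat.Coprime (M.toAddSubgroup.relIndex K.toAddSubgroup)
        (K.toAddSubgroup.relIndex I.toAddSubgroup) → K ∈ rightIdeals O)
    (O₁ O₂ : Submodule ℤ D) {ℓ n : ℕ} (hℓ : ℓ ≠ 0) (hn : n ≠ 0) (hℓn : Nat.Coprime ℓ n) :
    uMatrix O O₁ O₂ ℓ * matrix O n = matrix O n * uMatrix O O₁ O₂ ℓ := by
  have hTI := isTranslationInvariant_isForward O₁ O₂ ℓ
  have hTT : IsTranslationInvariant (fun _ _ : Submodule ℤ D => True) := fun _ _ _ => Iff.rfl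
  -- `U_ℓ T_n = F(ℓ n)` with the bottom filter `IsForward O₁ O₂ ℓ`
  have h1 : uMatrix O O₁ O₂ ℓ * matrix O n = matrixWith O (IsForward O₁ O₂ ℓ) (ℓ * n) := by
    rw [uMatrix, ← matrixWith_true O n]
    refine matrixWith_mul_matrixWith_of_coprime hcl hK hTI hℓ hn hℓn fun M L I hML hLI hidxML hidxLI => ?_
    rw [true_and]
    refine isForward_iff_of_coprime_outer hML hLI ?_
    rw [hidxLI]; exact (Nat.Coprime.pow_left 2 hℓn.symm)
  have h2 : matrix O n * uMatrix O O₁ O₂ ℓ = matrixWith O (IsForward O₁ O₂ ℓ) (n * ℓ) := by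
    rw [uMatrix, ← matrixWith_true O n]
    refine matrixWith_mul_matrixWith_of_coprime hcl hK hTT hn hℓ hℓn.symm fun M L I hML hLI hidxML hidxLI => ?_
    rw [and_true]
    refine isForward_iff_of_coprime_inner hML hLI ?_
    rw [hidxML]; exact (Nat.Coprime.pow_left 2 hℓn.symm)
  rw [h1, h2, mul_comm]


/-- **`U_ℓ U_{ℓ'} = U_{ℓ'} U_ℓ` for coprime non-zero `ℓ, ℓ'`** (abstract form, same orientation
data `(O₁, O₂)`): both products are the filtered matrix of index `ℓ ℓ'` for the conjunction of the
two forward filters. [cite: WZhang2014, §3.9 p. 214 (`𝕋_{N⁺,N⁻}` generated by `T_ℓ`, `U_ℓ`; commutation)] -/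
theorem uMatrix_mul_uMatrix_comm_of_forall_mem_rightIdeals [IsAddTorsionFree D] {O : Submodule ℤ D}
    [Fintype (ClassSet O)] [DecidableEq (ClassSet O)]
    (hcl : ∀ I ∈ rightIdeals O, ∀ β : Dˣ, β • I ∈ rightIdeals O)
    (hK : ∀ M ∈ rightIdeals O, ∀ I ∈ rightIdeals O, ∀ K : Submodule ℤ D, M ≤ K → K ≤ I →
      Nat.Coprime (M.toAddSubgroup.relIndex K.toAddSubgroup)
        (K.toAddSubgroup.relIndex I.toAddSubgroup) → K ∈ rightIdeals O)
    (O₁ O₂ : Submodule ℤ D) {ℓ ℓ' : ℕ} (hℓ : ℓ ≠ 0) (hℓ' : ℓ' ≠ 0) (hℓℓ' : Nat.Coprime ℓ ℓ') :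
    uMatrix O O₁ O₂ ℓ * uMatrix O O₁ O₂ ℓ' = uMatrix O O₁ O₂ ℓ' * uMatrix O O₁ O₂ ℓ := by
  have h1 : uMatrix O O₁ O₂ ℓ * uMatrix O O₁ O₂ ℓ' =
      matrixWith O (fun M I => IsForward O₁ O₂ ℓ' M I ∧ IsForward O₁ O₂ ℓ M I) (ℓ * ℓ') := by
    refine matrixWith_mul_matrixWith_of_coprime hcl hK (isTranslationInvariant_isForward O₁ O₂ ℓ)
      hℓ hℓ' hℓℓ' fun M L I hML hLI hidxML hidxLI => ?_
    refine and_congr (isForward_iff_of_coprime_inner hML hLI ?_) (isForward_iff_of_coprime_outer hML hLI ?_)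
    · rw [hidxML]; exact Nat.Coprime.pow_left 2 hℓℓ'
    · rw [hidxLI]; exact Nat.Coprime.pow_left 2 hℓℓ'.symm
  have h2 : uMatrix O O₁ O₂ ℓ' * uMatrix O O₁ O₂ ℓ =
      matrixWith O (fun M I => IsForward O₁ O₂ ℓ M I ∧ IsForward O₁ O₂ ℓ' M I) (ℓ' * ℓ) := by
    refine matrixWith_mul_matrixWith_of_coprime hcl hK (isTranslationInvariant_isForward O₁ O₂ ℓ')
      hℓ' hℓ hℓℓ'.symm fun M L I hML hLI hidxML hidxLI => ?_
    refine and_congr (isForward_iff_of_coprime_inner hML hLI ?_) (isForward_iff_of_coprime_outer hML hLI ?_)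
    · rw [hidxML]; exact Nat.Coprime.pow_left 2 hℓℓ'.symm
    · rw [hidxLI]; exact Nat.Coprime.pow_left 2 hℓℓ'
  have hR : (fun M I : Submodule ℤ D => IsForward O₁ O₂ ℓ' M I ∧ IsForward O₁ O₂ ℓ M I) =
      fun M I => IsForward O₁ O₂ ℓ M I ∧ IsForward O₁ O₂ ℓ' M I := by
    funext M I; exact propext and_comm
  rw [h1, h2, hR, mul_comm]

end Brandt

/-! ### Totally definite quaternion algebras over `ℚ` and Brandt setups -/

namespace Brandt

variable {D : Type u} [Ring D] [Algebra ℚ D] [IsQuaternionAlgebra ℚ D]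

/-- **`U_ℓ T(n) = T(n) U_ℓ`** (`gcd(ℓ, n) = 1`, `ℓ, n ≠ 0`) for a `ℤ`-order `O` of a totally
definite quaternion algebra over `ℚ` and any orientation data `(O₁, O₂)` (the standing hypotheses
discharged by `units_smul_mem_rightIdeals_of_isTotallyDefinite` and
`mem_rightIdeals_of_coprime_intermediate`). [cite: WZhang2014, §3.9 p. 214 (`𝕋_{N⁺,N⁻}` generated by `T_ℓ`, `U_ℓ`; commutation)] -/
theorem uMatrix_mul_matrix_comm (hdef : IsTotallyDefinite ℚ D) {O : Submodule ℤ D}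
    (hO : IsOrder D O) [Fintype (ClassSet O)] (O₁ O₂ : Submodule ℤ D) {ℓ n : ℕ} (hℓ : ℓ ≠ 0)
    (hn : n ≠ 0) (hℓn : Nat.Coprime ℓ n) :
    uMatrix O O₁ O₂ ℓ * matrix O n = matrix O n * uMatrix O O₁ O₂ ℓ := by
  classical
  haveI : IsAddTorsionFree D := isAddTorsionFree_of_charZero_module ℚ D
  exact uMatrix_mul_matrix_comm_of_forall_mem_rightIdeals
    (fun _ hI β => units_smul_mem_rightIdeals_of_isTotallyDefinite hdef hO hI β)
    (fun _ hM _ hI _ hMK hKI hcop => mem_rightIdeals_of_coprime_intermediate hdef hO hM hI hMK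
      hKI hcop) O₁ O₂ hℓ hn hℓn

/-- **`U_ℓ U_{ℓ'} = U_{ℓ'} U_ℓ`** (`gcd(ℓ, ℓ') = 1`, `ℓ, ℓ' ≠ 0`) in the totally definite case. [cite: WZhang2014, §3.9 p. 214 (`𝕋_{N⁺,N⁻}` generated by `T_ℓ`, `U_ℓ`; commutation)] -/
theorem uMatrix_mul_uMatrix_comm (hdef : IsTotallyDefinite ℚ D) {O : Submodule ℤ D}
    (hO : IsOrder D O) [Fintype (ClassSet O)] (O₁ O₂ : Submodule ℤ D) {ℓ ℓ' : ℕ} (hℓ : ℓ ≠ 0)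
    (hℓ' : ℓ' ≠ 0) (hℓℓ' : Nat.Coprime ℓ ℓ') :
    uMatrix O O₁ O₂ ℓ * uMatrix O O₁ O₂ ℓ' = uMatrix O O₁ O₂ ℓ' * uMatrix O O₁ O₂ ℓ := by
  classical
  haveI : IsAddTorsionFree D := isAddTorsionFree_of_charZero_module ℚ D
  exact uMatrix_mul_uMatrix_comm_of_forall_mem_rightIdeals
    (fun _ hI β => units_smul_mem_rightIdeals_of_isTotallyDefinite hdef hO hI β)
    (fun _ hM _ hI _ hMK hKI hcop => mem_rightIdeals_of_coprime_intermediate hdef hO hM hI hMK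
      hKI hcop) O₁ O₂ hℓ hℓ' hℓℓ'

variable {Nplus Nminus : ℕ} (S : XiSetup Nplus Nminus) [Fintype (ClassSet S.O)]

/-- **`U_ℓ T(n) = T(n) U_ℓ`** for a Brandt setup and its chosen orientation (`gcd(ℓ, n) = 1`,
`ℓ, n ≠ 0`). [cite: WZhang2014, §3.9 p. 214 (`𝕋_{N⁺,N⁻}` generated by `T_ℓ`, `U_ℓ`; commutation)] -/
theorem XiSetup.uMatrix_mul_matrix_comm {ℓ n : ℕ} (hℓ : ℓ ≠ 0) (hn : n ≠ 0)
    (hℓn : Nat.Coprime ℓ n) : S.uMatrix ℓ * matrix S.O n = matrix S.O n * S.uMatrix ℓ :=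
  Brandt.uMatrix_mul_matrix_comm S.isTotallyDefinite S.isEichlerOrder.isOrder S.O₁ S.O₂ hℓ hn hℓn

/-- **`U_ℓ U_{ℓ'} = U_{ℓ'} U_ℓ`** for a Brandt setup (`gcd(ℓ, ℓ') = 1`, `ℓ, ℓ' ≠ 0`). [cite: WZhang2014, §3.9 p. 214 (`𝕋_{N⁺,N⁻}` generated by `T_ℓ`, `U_ℓ`; commutation)] -/
theorem XiSetup.uMatrix_mul_uMatrix_comm {ℓ ℓ' : ℕ} (hℓ : ℓ ≠ 0) (hℓ' : ℓ' ≠ 0)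
    (hℓℓ' : Nat.Coprime ℓ ℓ') : S.uMatrix ℓ * S.uMatrix ℓ' = S.uMatrix ℓ' * S.uMatrix ℓ :=
  Brandt.uMatrix_mul_uMatrix_comm S.isTotallyDefinite S.isEichlerOrder.isOrder S.O₁ S.O₂ hℓ hℓ' hℓℓ'

/-- **The Hecke matrices `S.heckeAt p`, `S.heckeAt q` of a Brandt setup at any two primes
commute** (`U U`, `U T`, `T U` by the above, `T T` by the tree's `XiSetup.matrix_comm_of_coprime`). [cite: WZhang2014, §3.9 p. 214 (`𝕋_{N⁺,N⁻}` generated by `T_ℓ`, `U_ℓ`; commutation)] -/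
theorem XiSetup.heckeAt_comm {p q : ℕ} (hp : p.Prime) (hq : q.Prime) :
    S.heckeAt p * S.heckeAt q = S.heckeAt q * S.heckeAt p := by
  by_cases hpq : p = q
  · rw [hpq]
  have hcop : Nat.Coprime p q := (Nat.coprime_primes hp hq).mpr hpq
  by_cases hpN : p ∣ Nplus <;> by_cases hqN : q ∣ Nplus
  · rw [S.heckeAt_of_dvd hpN, S.heckeAt_of_dvd hqN]
    exact S.uMatrix_mul_uMatrix_comm hp.ne_zero hq.ne_zero hcop
  · rw [S.heckeAt_of_dvd hpN, S.heckeAt_of_not_dvd hqN]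
    exact S.uMatrix_mul_matrix_comm hp.ne_zero hq.ne_zero hcop
  · rw [S.heckeAt_of_not_dvd hpN, S.heckeAt_of_dvd hqN]
    exact (S.uMatrix_mul_matrix_comm hq.ne_zero hp.ne_zero hcop.symm).symm
  · rw [S.heckeAt_of_not_dvd hpN, S.heckeAt_of_not_dvd hqN]
    exact S.matrix_comm_of_coprime hcop

open scoped Classical in
/-- **The full Hecke algebra `𝕋_{N⁺,N⁻}(S) = ℤ[S.heckeAt p : p prime]` of a Brandt setup is
commutative** (its generators commute pairwise; Mathlib `Algebra.isMulCommutative_adjoin`; stated as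
an equation, no instance registered). [cite: WZhang2014, §3.9 p. 214 (`𝕋_{N⁺,N⁻}` generated by `T_ℓ`, `U_ℓ`; commutation)] -/
theorem XiSetup.fullHeckeAlgebra_comm {x y : Matrix (ClassSet S.O) (ClassSet S.O) ℤ}
    (hx : x ∈ S.fullHeckeAlgebra) (hy : y ∈ S.fullHeckeAlgebra) : x * y = y * x := by
  have hgen : ∀ a ∈ {X | ∃ p : ℕ, p.Prime ∧ X = Brandt.heckeAt S.O S.O₁ S.O₂ Nplus p},
      ∀ b ∈ {X | ∃ p : ℕ, p.Prime ∧ X = Brandt.heckeAt S.O S.O₁ S.O₂ Nplus p}, a * b = b * a := by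
    rintro _ ⟨p, hp, rfl⟩ _ ⟨q, hq, rfl⟩
    exact S.heckeAt_comm hp hq
  have hcomm := (Algebra.isMulCommutative_adjoin ℤ hgen).is_comm.comm ⟨x, hx⟩ ⟨y, hy⟩
  exact congrArg Subtype.val hcomm

end Brandt

end Literature.NumberTheory.Automorphic

end
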